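import Literature.MathematicalPhysics.QuantumFieldTheory.GaugeOSData
import Literature.MathematicalPhysics.QuantumFieldTheory.YangMillsOS
import Literature.MathematicalPhysics.QuantumFieldTheory.LatticeMassGap
import Literature.MathematicalPhysics.QuantumFieldTheory.LatticeMassGapProofs
import Literature.MathematicalPhysics.QuantumFieldTheory.LatticeGaugeProofs
import Literature.MathematicalPhysics.QuantumFieldTheory.ConstructiveQFTWave0OddRPProofs
import Literature.Probability.LatticeModels.OSReconstruction
import Literature.MathematicalPhysics.QuantumLattice.LatticeGaugeDLR
import HarnessLib

/-!
# Torus clustering on a dense set of OS vectors forces the infinite-volume transfer gap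

Stub `stub_gapFromClustering` (RQb2) of the crux `ClusteringToYangMills`
(`Summit.QuantumFields.YangMills.Theses.FradkinShenkerFlow.ClusteringToYangMills`,
stmt-QuantumFields-9443), line `spectral-requantisation-dock`.

**Statement.** Let `G` be a compact group, `r` a lattice representation, `β ≥ 0`, `m > 0`, and
assume volume-uniform Euclidean-time clustering `TorusClusteringAt r β m` of the odd-torus Wilson
states. Let `μ` be an odd-torus limit state (`oddTorusLimitPoints r β`) which is
Osterwalder–Schrader reconstructible for the bond time reflection `gaugeTimeReflect`, the unit time
shift `gaugeTimeShift` and the positive-time σ-algebra `posTimeEvents G`, and assume that the OS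
images of the complex span of the continuous positive-time gauge-invariant local observables
`contPosTimeObs G` are dense in the OS Hilbert space. Then the reconstructed transfer data have a
mass gap `≥ m`: `‖T P_{Ω^⊥}‖ ≤ e^{-m}` (`TransferData.HasMassGap`).

**Proof.** The abstract core is the tree's
`Literature.MathematicalPhysics.QuantumFieldTheory.gapNorm_le_exp_of_dense_clustering`
(Glimm–Jaffe 1987, §6.1, Thm. 6.1.3 (iii) and §19.7; Osterwalder–Seiler 1978, §2): it suffices to
bound `⟪v, Tᵗ v⟫ - ⟪v, Ω⟫⟪Ω, v⟫` by `C_v e^{-mt}` for `v` in the dense set. We show the bound for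
all pairs `(u, v)` in the span of the OS images of `contPosTimeObs G`:
* the clustered quantity is sesquilinear in `(u, v)`, so by `Submodule.span_induction₂` it is
  enough to treat `u = ι A`, `v = ι B` with `A, B ∈ contPosTimeObs G` (`clustering_span`), and the
  OS map `ι = h.osMap` is linear on the bounded positive-time observables, which contain the span
  (`osMap_mem_span`, `isBoundedMeasurable_of_mem_contPosTimeObs`);
* for `A = A₀.F`, `B = B₀.F` (real, continuous, gauge-invariant cylinder observables supported at
  positive times) the OS reconstruction gives
  `⟪ι A, Tᵗ ι B⟫ - ⟪ι A, Ω⟫⟪Ω, ι B⟫ = ∫ (A₀ ∘ Θ) · (B₀ ∘ τᵗ) dμ - (∫ A₀ ∘ Θ dμ)(∫ B₀ dμ)`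
  (`IsOSReconstructible.inner_osMap_transfer_pow_osMap`), where `τᵗ = configShift (-t e₀)`
  (`iterate_gaugeTimeShift`) and `A₀ ∘ Θ` is again a gauge-invariant local observable
  (`exists_species_comp_gaugeTimeReflect`: `Θ` intertwines the gauge transformation `g` with
  `g ∘ θ`, `gaugeTimeReflect_gaugeTransformZd`);
* this real number is the limit along the odd tori `2 S_k + 1` of the torus connected correlations
  `latticeConnectedCorr r.ρ β (2 S_k + 1) (A₀ ∘ Θ) B₀ t` (definition of `oddTorusLimitPoints` /
  `IsInfiniteVolumeLimitAlong` applied to the three bounded continuous cylinder functions), which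
  are bounded by `C e^{-mt}` as soon as `t ≤ S_k` (`TorusClusteringAt`), i.e. eventually in `k`.

References: J. Glimm, A. Jaffe, *Quantum Physics* (2nd ed., 1987), §6.1 and §19.7;
K. Osterwalder, E. Seiler, Ann. Phys. 110 (1978), §2; E. Seiler, LNP 159 (1982), Ch. 2.
-/

noncomputable section

open scoped BigOperators Topology ENNReal InnerProductSpace ComplexConjugate
open MeasureTheory Filter

open Literature.MathematicalPhysics.QuantumFieldTheory Literature.MathematicalPhysics.QuantumLattice
open Literature.Probability.LatticeModels (IsOSReconstructible IsBoundedMeasurable positiveEvents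
  TransferData)

namespace Summit.QuantumFields.YangMills.Theorems.ClusteringToYangMills

/-! ### Sesquilinear extension of a clustering bound (abstract Hilbert space) -/

/-- The clustering bound `‖⟪u, Tᵗ v⟫ - ⟪u, Ω⟫⟪Ω, v⟫‖ ≤ C_{u,v} e^{-mt}` is sesquilinear-closed:
if it holds for all pairs of a set `M` of vectors, it holds for all pairs of the span of `M`.
[folklore] -/
private theorem clustering_span {H : Type*} [NormedAddCommGroup H] [InnerProductSpace ℂ H]
    [CompleteSpace H] (D : TransferData H) (m : ℝ) {M : Set H}
    (hM : ∀ u ∈ M, ∀ v ∈ M, ∃ C : ℝ, ∀ t : ℕ,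
      ‖⟪u, (D.T ^ t) v⟫_ℂ - ⟪u, D.vacuum⟫_ℂ * ⟪D.vacuum, v⟫_ℂ‖ ≤ C * Real.exp (-m * t))
    {u v : H} (hu : u ∈ Submodule.span ℂ M) (hv : v ∈ Submodule.span ℂ M) :
    ∃ C : ℝ, ∀ t : ℕ,
      ‖⟪u, (D.T ^ t) v⟫_ℂ - ⟪u, D.vacuum⟫_ℂ * ⟪D.vacuum, v⟫_ℂ‖ ≤ C * Real.exp (-m * t) := by
  refine Submodule.span_induction₂ (p := fun u v _ _ => ∃ C : ℝ, ∀ t : ℕ,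
      ‖⟪u, (D.T ^ t) v⟫_ℂ - ⟪u, D.vacuum⟫_ℂ * ⟪D.vacuum, v⟫_ℂ‖ ≤ C * Real.exp (-m * t))
    (fun x y hx hy => hM x hx y hy) (fun y _ => ⟨0, fun t => by simp⟩)
    (fun x _ => ⟨0, fun t => by simp⟩) ?_ ?_ ?_ ?_ hu hv
  · rintro x y z - - - ⟨C₁, hC₁⟩ ⟨C₂, hC₂⟩
    refine ⟨C₁ + C₂, fun t => ?_⟩
    have e : ⟪x + y, (D.T ^ t) z⟫_ℂ - ⟪x + y, D.vacuum⟫_ℂ * ⟪D.vacuum, z⟫_ℂ =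
        (⟪x, (D.T ^ t) z⟫_ℂ - ⟪x, D.vacuum⟫_ℂ * ⟪D.vacuum, z⟫_ℂ) +
          (⟪y, (D.T ^ t) z⟫_ℂ - ⟪y, D.vacuum⟫_ℂ * ⟪D.vacuum, z⟫_ℂ) := by
      rw [inner_add_left, inner_add_left]; ring
    rw [e, add_mul]
    exact (norm_add_le _ _).trans (add_le_add (hC₁ t) (hC₂ t))
  · rintro x y z - - - ⟨C₁, hC₁⟩ ⟨C₂, hC₂⟩
    refine ⟨C₁ + C₂, fun t => ?_⟩
    have e : ⟪x, (D.T ^ t) (y + z)⟫_ℂ - ⟪x, D.vacuum⟫_ℂ * ⟪D.vacuum, y + z⟫_ℂ =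
        (⟪x, (D.T ^ t) y⟫_ℂ - ⟪x, D.vacuum⟫_ℂ * ⟪D.vacuum, y⟫_ℂ) +
          (⟪x, (D.T ^ t) z⟫_ℂ - ⟪x, D.vacuum⟫_ℂ * ⟪D.vacuum, z⟫_ℂ) := by
      rw [map_add, inner_add_right, inner_add_right]; ring
    rw [e, add_mul]
    exact (norm_add_le _ _).trans (add_le_add (hC₁ t) (hC₂ t))
  · rintro a x y - - ⟨C, hC⟩
    refine ⟨‖a‖ * C, fun t => ?_⟩
    have e : ⟪a • x, (D.T ^ t) y⟫_ℂ - ⟪a • x, D.vacuum⟫_ℂ * ⟪D.vacuum, y⟫_ℂ =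
        conj a * (⟪x, (D.T ^ t) y⟫_ℂ - ⟪x, D.vacuum⟫_ℂ * ⟪D.vacuum, y⟫_ℂ) := by
      rw [inner_smul_left, inner_smul_left]; ring
    rw [e, norm_mul, Complex.norm_conj, mul_assoc]
    exact mul_le_mul_of_nonneg_left (hC t) (norm_nonneg a)
  · rintro a x y - - ⟨C, hC⟩
    refine ⟨‖a‖ * C, fun t => ?_⟩
    have e : ⟪x, (D.T ^ t) (a • y)⟫_ℂ - ⟪x, D.vacuum⟫_ℂ * ⟪D.vacuum, a • y⟫_ℂ =
        a * (⟪x, (D.T ^ t) y⟫_ℂ - ⟪x, D.vacuum⟫_ℂ * ⟪D.vacuum, y⟫_ℂ) := by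
      rw [map_smul, inner_smul_right, inner_smul_right]; ring
    rw [e, norm_mul, mul_assoc]
    exact mul_le_mul_of_nonneg_left (hC t) (norm_nonneg a)

/-! ### Linearity of the OS map on the bounded positive-time observables -/

section OSMap

variable {Ω : Type*} {mΩ : MeasurableSpace Ω} {μ : Measure Ω} {reflect shift : Ω → Ω}
  {mpos : MeasurableSpace Ω}

/-- `ι 0 = 0`. [folklore] -/
private theorem osMap_zero (h : IsOSReconstructible μ reflect shift mpos) [IsProbabilityMeasure μ] :
    h.osMap 0 = 0 := by
  rw [h.osMap_eq (Literature.Probability.LatticeModels.boundedMeasurable mpos).zero_mem]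
  exact map_zero h.vec

/-- `ι (F + G) = ι F + ι G` on `ℰ₊`. [folklore] -/
private theorem osMap_add (h : IsOSReconstructible μ reflect shift mpos) [IsProbabilityMeasure μ]
    {F G : Ω → ℂ} (hF : IsBoundedMeasurable mpos F) (hG : IsBoundedMeasurable mpos G) :
    h.osMap (F + G) = h.osMap F + h.osMap G := by
  rw [h.osMap_eq hF, h.osMap_eq hG,
    h.osMap_eq ((Literature.Probability.LatticeModels.boundedMeasurable mpos).add_mem hF hG),
    ← map_add]
  rfl

/-- `ι (a • F) = a • ι F` on `ℰ₊`. [folklore] -/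
private theorem osMap_smul (h : IsOSReconstructible μ reflect shift mpos) [IsProbabilityMeasure μ]
    (a : ℂ) {F : Ω → ℂ} (hF : IsBoundedMeasurable mpos F) :
    h.osMap (a • F) = a • h.osMap F := by
  rw [h.osMap_eq hF,
    h.osMap_eq ((Literature.Probability.LatticeModels.boundedMeasurable mpos).smul_mem a hF),
    ← map_smul]
  rfl

/-- The OS map sends the span of a set `M ⊆ ℰ₊` of bounded positive-time observables into the
span of the OS images of `M` (linearity of `ι` on `ℰ₊`). [folklore] -/
private theorem osMap_mem_span (h : IsOSReconstructible μ reflect shift mpos)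
    [IsProbabilityMeasure μ] {M : Set (Ω → ℂ)} (hM : ∀ F ∈ M, IsBoundedMeasurable mpos F)
    {F : Ω → ℂ} (hF : F ∈ Submodule.span ℂ M) :
    h.osMap F ∈ Submodule.span ℂ (h.osMap '' M) := by
  have hle : Submodule.span ℂ M ≤ Literature.Probability.LatticeModels.boundedMeasurable mpos :=
    Submodule.span_le.2 hM
  induction hF using Submodule.span_induction with
  | mem F hF => exact Submodule.subset_span ⟨F, hF, rfl⟩
  | zero => rw [osMap_zero h]; exact zero_mem _
  | add F G hF hG ihF ihG => rw [osMap_add h (hle hF) (hle hG)]; exact add_mem ihF ihG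
  | smul a F hF ih => rw [osMap_smul h a (hle hF)]; exact Submodule.smul_mem _ a ih

end OSMap

/-! ### Geometry of the bond time reflection and the time shift on `ℤ⁴` gauge fields -/

section Geometry

variable {G : Type}

/-- `θ(x + e₀) + e₀ = θ x` for the site reflection `θ : x₀ ↦ -1 - x₀`. [folklore] -/
private theorem reflect_add_e0_add_e0 (x : Literature.Probability.LatticeModels.Site 4) :
    latticeTimeReflection 4 (x + Pi.single 0 1) + Pi.single 0 1 = latticeTimeReflection 4 x := by
  ext j
  by_cases hj : j = 0
  · subst hj
    simp only [latticeTimeReflection_apply, Pi.add_apply, Function.update_self, Pi.single_eq_same]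
    ring
  · simp [latticeTimeReflection_apply, hj]

/-- `θ(x + eᵢ) = θ x + eᵢ` for a spatial direction `i ≠ 0`. [folklore] -/
private theorem reflect_add_single_of_ne (x : Literature.Probability.LatticeModels.Site 4) {i : Fin 4}
    (hi : i ≠ 0) :
    latticeTimeReflection 4 (x + Pi.single i 1) = latticeTimeReflection 4 x + Pi.single i 1 := by
  ext j
  by_cases hj : j = 0
  · subst hj
    simp [latticeTimeReflection_apply, Pi.single_eq_of_ne (Ne.symm hi)]
  · simp [latticeTimeReflection_apply, hj]

/-- **`Θ` intertwines gauge transformations**: `Θ (U^g) = (Θ U)^{g ∘ θ}`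
(Osterwalder–Seiler 1978, §2: the reflection maps gauge-invariant observables at negative times
to gauge-invariant observables at positive times). [folklore] -/
private theorem gaugeTimeReflect_gaugeTransformZd [Group G]
    (g : Literature.Probability.LatticeModels.Site 4 → G) (U : LGConfig 4 G) :
    gaugeTimeReflect (gaugeTransformZd g U) =
      gaugeTransformZd (g ∘ latticeTimeReflection 4) (gaugeTimeReflect U) := by
  funext e
  obtain ⟨x, i⟩ := e
  by_cases hi : i = 0
  · subst hi
    simp only [gaugeTimeReflect_apply, gaugeTransformZd, if_true, Function.comp_apply,
      reflect_add_e0_add_e0, mul_inv_rev, inv_inv, mul_assoc]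
  · simp only [gaugeTimeReflect_apply, gaugeTransformZd, if_neg hi, Function.comp_apply,
      reflect_add_single_of_ne x hi]

/-- `Θ` is continuous (coordinate permutation and inversion). [folklore] -/
private theorem continuous_gaugeTimeReflect [Group G] [TopologicalSpace G] [ContinuousInv G] :
    Continuous (gaugeTimeReflect : LGConfig 4 G → LGConfig 4 G) := by
  refine continuous_pi fun e => ?_
  by_cases h0 : e.2 = 0
  · simp only [gaugeTimeReflect, h0, if_true]
    exact (continuous_apply _).inv
  · simp only [gaugeTimeReflect, h0, if_false]
    exact continuous_apply _

/-- `Θ` is measurable for the product σ-algebra. [folklore] -/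
private theorem measurable_gaugeTimeReflect [Group G] [MeasurableSpace G] [MeasurableInv G] :
    Measurable (gaugeTimeReflect : LGConfig 4 G → LGConfig 4 G) := by
  refine measurable_pi_lambda _ fun e => ?_
  by_cases h0 : e.2 = 0
  · simp only [gaugeTimeReflect, h0, if_true]
    exact (measurable_pi_apply _).inv
  · simp only [gaugeTimeReflect, h0, if_false]
    exact measurable_pi_apply _

/-- Iterates of the unit time shift: `τᵗ = configShift (-t e₀)`, i.e. `(τᵗ U)(x, i) = U(x + t e₀, i)`
— the translation entering the second observable of `latticeConnectedCorr`. [folklore] -/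
private theorem iterate_gaugeTimeShift [MeasurableSpace G] (t : ℕ) (U : LGConfig 4 G) :
    gaugeTimeShift^[t] U = configShift (-Pi.single 0 (t : ℤ)) U := by
  induction t generalizing U with
  | zero => funext e; simp [configShift_apply]
  | succ t ih =>
    rw [Function.iterate_succ_apply, ih]
    funext e
    simp only [configShift_apply, gaugeTimeShift_apply, sub_neg_eq_add, Nat.cast_succ,
      Pi.single_add, add_assoc]

/-- **The reflected species.** For a gauge-invariant local observable `A`, `A ∘ Θ` is again a
gauge-invariant local observable (supported on the reflected links; gauge invariance by
`gaugeTimeReflect_gaugeTransformZd`). [folklore] -/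
private theorem exists_species_comp_gaugeTimeReflect [Group G] [MeasurableSpace G]
    [MeasurableInv G] (A : YMSpecies G) : ∃ A' : YMSpecies G, ∀ U, A'.F U = A.F (gaugeTimeReflect U) := by
  classical
  obtain ⟨C, hC⟩ := A.bounded
  refine ⟨{ F := fun U => A.F (gaugeTimeReflect U)
            supp := A.supp.image fun e =>
              if e.2 = 0 then (latticeTimeReflection 4 (e.1 + Pi.single 0 1), (0 : Fin 4))
              else (latticeTimeReflection 4 e.1, e.2)
            isCylinder := ?_
            gaugeInvariant := fun g U => ?_
            bounded := ⟨C, fun U => hC _⟩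
            measurable := A.measurable.comp measurable_gaugeTimeReflect }, fun U => rfl⟩
  · intro U V hUV
    refine A.isCylinder fun e he => ?_
    have key := hUV (if e.2 = 0 then (latticeTimeReflection 4 (e.1 + Pi.single 0 1), (0 : Fin 4))
        else (latticeTimeReflection 4 e.1, e.2))
      (Finset.mem_coe.2 (Finset.mem_image_of_mem _ (Finset.mem_coe.1 he)))
    by_cases h0 : e.2 = 0
    · rw [if_pos h0] at key
      rw [gaugeTimeReflect_apply, gaugeTimeReflect_apply, if_pos h0, if_pos h0, key]
    · rw [if_neg h0] at key
      rw [gaugeTimeReflect_apply, gaugeTimeReflect_apply, if_neg h0, if_neg h0, key]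
  · show A.F (gaugeTimeReflect (gaugeTransformZd g U)) = A.F (gaugeTimeReflect U)
    rw [gaugeTimeReflect_gaugeTransformZd]
    exact A.gaugeInvariant _ _

/-- Continuous positive-time species are bounded `𝓔₊`-measurable (a cylinder function supported in
`posTimeEdges` factors through the padding of the positive-time coordinates). [folklore] -/
private theorem isBoundedMeasurable_of_mem_contPosTimeObs [Group G] [MeasurableSpace G]
    [TopologicalSpace G] {F : LGConfig 4 G → ℂ} (hF : F ∈ contPosTimeObs G) : IsBoundedMeasurable (posTimeEvents G) F := by
  classical
  obtain ⟨A, -, hsupp, rfl⟩ := hF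
  obtain ⟨C, hC⟩ := A.bounded
  refine ⟨Complex.measurable_ofReal.comp ?_, C, fun U => by
    rw [Complex.norm_real, Real.norm_eq_abs]; exact hC U⟩
  have hpad : Measurable[posTimeEvents G]
      (fun (U : LGConfig 4 G) e => if e ∈ A.supp then U e else (1 : G)) := by
    refine @measurable_pi_lambda _ _ _ (posTimeEvents G) _ _ fun e => ?_
    by_cases he : e ∈ A.supp
    · simp only [he, if_true]
      exact measurable_cylinderEvent_apply (hsupp (Finset.mem_coe.2 he))
    · simp only [he, if_false]
      exact measurable_const
  have hfac : A.F = A.F ∘ fun (U : LGConfig 4 G) e => if e ∈ A.supp then U e else 1 :=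
    funext fun U => A.isCylinder fun e he => by
      simp only [if_pos (Finset.mem_coe.1 he)]
  rw [hfac]
  exact A.measurable.comp hpad

end Geometry

/-! ### Clustering of the OS matrix elements of continuous positive-time species -/

/-- **Torus clustering passes to the OS matrix elements of the limit state.** For
`A, B ∈ contPosTimeObs G`, `⟪ι A, Tᵗ ι B⟫ - ⟪ι A, Ω⟫⟪Ω, ι B⟫` is the limit of the torus connected
correlations `latticeConnectedCorr r.ρ β (2S_k+1) (A ∘ Θ) B t`, hence bounded by `C e^{-mt}`.
[folklore] -/
private theorem clustering_contPosTimeObs {G : Type} [Group G] [TopologicalSpace G]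
    [IsTopologicalGroup G] [CompactSpace G] [MeasurableSpace G] [BorelSpace G]
    (r : LatticeRep G) {β m : ℝ} (hcl : TorusClusteringAt r β m)
    {μ : Measure (LGConfig 4 G)} [IsProbabilityMeasure μ] (hμ : μ ∈ oddTorusLimitPoints r β)
    (h : IsOSReconstructible μ gaugeTimeReflect gaugeTimeShift (posTimeEvents G))
    {A B : LGConfig 4 G → ℂ} (hA : A ∈ contPosTimeObs G) (hB : B ∈ contPosTimeObs G) :
    ∃ C : ℝ, ∀ t : ℕ,
      ‖⟪h.osMap A, (h.transferData.T ^ t) (h.osMap B)⟫_ℂ -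
          ⟪h.osMap A, h.transferData.vacuum⟫_ℂ * ⟪h.transferData.vacuum, h.osMap B⟫_ℂ‖ ≤
        C * Real.exp (-m * t) := by
  have hAbm := isBoundedMeasurable_of_mem_contPosTimeObs hA
  have hBbm := isBoundedMeasurable_of_mem_contPosTimeObs hB
  obtain ⟨A₀, hAc, -, rfl⟩ := hA
  obtain ⟨B₀, hBc, -, rfl⟩ := hB
  obtain ⟨A₁, hA₁⟩ := exists_species_comp_gaugeTimeReflect A₀
  obtain ⟨C, hC⟩ := hcl A₁ B₀
  obtain ⟨S, hS, hlim⟩ := hμ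
  have hA₁c : Continuous A₁.F := by
    have e : A₁.F = A₀.F ∘ gaugeTimeReflect := funext hA₁
    rw [e]
    exact hAc.comp continuous_gaugeTimeReflect
  obtain ⟨CA, hCA⟩ := A₁.bounded
  obtain ⟨CB, hCB⟩ := B₀.bounded
  refine ⟨C, fun t => ?_⟩
  have hOS := h.isOSRealisation
  rw [← hOS.integral_conj_comp_reflect_mul_comp_iterate hAbm hBbm t,
    ← hOS.integral_conj_comp_reflect hAbm, ← hOS.integral_eq_inner_vacuum hBbm]
  simp only [Complex.conj_ofReal, ← Complex.ofReal_mul, integral_complex_ofReal,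
    ← Complex.ofReal_sub, Complex.norm_real, Real.norm_eq_abs, iterate_gaugeTimeShift]
  -- the three torus limits
  have hΨcyl : IsCylinder (fun U => A₁.F U * B₀.F (configShift (-Pi.single 0 (t : ℤ)) U)) _ :=
    IsCylinder.mul A₁.isCylinder (IsCylinder.comp_configShift B₀.isCylinder _)
  have hΨc : Continuous fun U => A₁.F U * B₀.F (configShift (-Pi.single 0 (t : ℤ)) U) :=
    hA₁c.mul (hBc.comp (continuous_configShift _))
  have hΨb : ∃ C, ∀ U, |A₁.F U * B₀.F (configShift (-Pi.single 0 (t : ℤ)) U)| ≤ C :=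
    ⟨CA * CB, fun U => by
      rw [abs_mul]
      exact mul_le_mul (hCA U) (hCB _) (abs_nonneg _) ((abs_nonneg _).trans (hCA U))⟩
  have t1 := hlim.2 _ _ hΨcyl hΨc hΨb
  have t2 := hlim.2 _ _ A₁.isCylinder hA₁c ⟨CA, hCA⟩
  have t3 := hlim.2 _ _ B₀.isCylinder hBc ⟨CB, hCB⟩
  have T : Tendsto (fun k => latticeConnectedCorr r.ρ β (2 * S k + 1) A₁.F B₀.F t) atTop
      (𝓝 ((∫ U, A₁.F U * B₀.F (configShift (-Pi.single 0 (t : ℤ)) U) ∂μ) -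
        (∫ U, A₁.F U ∂μ) * ∫ U, B₀.F U ∂μ)) :=
    t1.sub (t2.mul t3)
  have hev : ∀ᶠ k in atTop,
      |latticeConnectedCorr r.ρ β (2 * S k + 1) A₁.F B₀.F t| ≤ C * Real.exp (-(m * t)) :=
    (eventually_ge_atTop t).mono fun k hk => hC (S k) t (hk.trans hS.le_apply)
  have key := le_of_tendsto T.abs hev
  simpa only [hA₁, neg_mul] using key

/-! ### The stub -/

/-- **RQb2 — torus clustering ⟹ infinite-volume transfer gap on a dense OS domain.** Under
volume-uniform Euclidean-time clustering `TorusClusteringAt r β m` (`m > 0`), every odd-torus limit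
state `μ` that is OS-reconstructible for `(gaugeTimeReflect, gaugeTimeShift, posTimeEvents G)` and
for which the OS images of `Submodule.span ℂ (contPosTimeObs G)` are dense has reconstructed
transfer data with `‖T P_{Ω^⊥}‖ ≤ e^{-m}` (Glimm–Jaffe 1987, Thm. 6.1.3 (iii) and §19.7;
Osterwalder–Seiler 1978, §2), by `gapNorm_le_exp_of_dense_clustering` fed with
`clustering_contPosTimeObs` extended sesquilinearly over the span. (The hypotheses
`IsCompactSimpleLieGroup G` and `0 ≤ β` of the registered signature are not used: measurability of
the species for `𝓔₊` comes from the cylinder property, not from second countability.) [folklore] -/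
theorem stub_gapFromClustering :
    ∀ (G : Type) [Group G] [TopologicalSpace G] [IsTopologicalGroup G] [CompactSpace G]
      [MeasurableSpace G] [BorelSpace G], IsCompactSimpleLieGroup G →
        ∀ (r : LatticeRep G) (β m : ℝ), 0 ≤ β → 0 < m → TorusClusteringAt r β m →
          ∀ (μ : Measure (LGConfig 4 G)) [IsProbabilityMeasure μ], μ ∈ oddTorusLimitPoints r β →
            ∀ h : IsOSReconstructible μ gaugeTimeReflect gaugeTimeShift (posTimeEvents G),
              Dense (h.osMap '' (Submodule.span ℂ (contPosTimeObs G) : Set (LGConfig 4 G → ℂ))) →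
                h.transferData.HasMassGap m := by
  intro G _ _ _ _ _ _ _ r β m _ hm hcl μ _ hμ h hdense
  refine ⟨hm, gapNorm_le_exp_of_dense_clustering h.transferData m hdense ?_⟩
  rintro _ ⟨F, hF, rfl⟩
  have hM : ∀ F ∈ contPosTimeObs G, IsBoundedMeasurable (posTimeEvents G) F := fun F hF =>
    isBoundedMeasurable_of_mem_contPosTimeObs hF
  have hv := osMap_mem_span h hM hF
  refine clustering_span h.transferData m ?_ hv hv
  rintro _ ⟨A, hA, rfl⟩ _ ⟨B, hB, rfl⟩
  exact clustering_contPosTimeObs r hcl hμ h hA hB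

end Summit.QuantumFields.YangMills.Theorems.ClusteringToYangMills

end
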